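import Summits.MatrixMultiplication.MatrixMultiplication.Theorems.AbelianSTPPCensusShapeCertVQSearch
import Summits.MatrixMultiplication.MatrixMultiplication.Theorems.AbelianSTPPCensusShapeCertVPFinal

/-!
# Abelian STPP census — soundness of `ShapeCertVQ` (part 5: from the route vocabulary to the checker)

Cell mm-stpp, rung F-M1; successor kernel item VQ-CERT in support of the closed crux item stmt-MatrixMultiplication-19191; seat
mm-stpp-vp-p2 (gen 1).  The bridge from the cell's vocabulary (`SieveAdmissibleVP`, `Beats`, and eng-2 g5's shape form
`STPPThreeRoomEnergy.E3pAdm` of the registered rule E3⁺ — vQ := vP ∧ E3⁺, CENSUS-PLAN §6.1 (ae)) to the checker's semantics: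
* `admE_GM` — `E3pAdm M a b c` gives the multiset form `AdmE M` for the shape multiset `ShapeCert.GM a b c`;
* `beats_gsumQ` — a beating family of order `M ≤ 489` has integer gain above `10⁶·M` (`gainQ_pow_le`);
* `shapeExclusionVQ_of_checkQ` — **if `checkQ M = true` (`M ≤ 489`) then no shape list with at least two members satisfying
  `SieveAdmissibleVP M` and `E3pAdm M` beats `5/2`** (with eng-2's `inUniv_shp`, `admM_GM` for the vM part and theory g6's
  `admG_GM` for U11-G in credit form, all reused).
The per-order kernel evaluations and the leaf beyond 337 are in `…ShapeCertVQEval*` / `…LeafTE…`.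
-/

set_option linter.dupNamespace false -- `MatrixMultiplication.MatrixMultiplication` (summit = problem, D-0017)
set_option autoImplicit false

namespace Summit.MatrixMultiplication.MatrixMultiplication.Theorems.ShapeCertVQ

open ShapeCert ShapeCertVP STPPThreeRoomEnergy Finset

section admE
/-! ### The E3⁺ condition on the shape multiset from its shape-list form -/

variable {N : ℕ}

/-- **`E3pAdm` gives `AdmE` on the shape multiset** (the off-member sums of `GM a b c` at the shape of member `i` are the sums over
the indices `≠ i`, eng-2's `ShapeCert.erase_sum_GM`) -/
theorem admE_GM {M : ℕ} (a b c : Fin N → ℕ) (hE : E3pAdm M a b c) : AdmE M (GM a b c) := by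
  intro x hx h2
  obtain ⟨i, rfl⟩ := (mem_GM a b c).mp hx
  rw [erase_sum_GM, erase_sum_GM, erase_sum_GM]
  have h := hE i (by simpa [shp, vol] using h2)
  simpa [shp, vol, pab, pbc, pca] using h

end admE

section gains
/-! ### Real gains versus integer gains (after eng-2's `rpow_le_gain`) -/

/-- `V^{5/6} ≤ gainQ(V)/10⁶` for `V ≤ 512` -/
theorem rpow_le_gainQ (V : ℕ) (hV : V ≤ 512) :
    ((V : ℕ) : ℝ) ^ ((5 / 2 : ℝ) / 3) ≤ (gainQ V : ℝ) / 1000000 := by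
  have h := gainQ_pow_le V hV
  have hx : (0 : ℝ) ≤ V := Nat.cast_nonneg V
  have hle : (V : ℝ) ^ 5 ≤ ((gainQ V : ℝ) / 1000000) ^ 6 := by
    rw [div_pow, le_div_iff₀ (by positivity)]
    exact_mod_cast h
  have e1 : ((5 / 2 : ℝ) / 3) = ((5 : ℕ) : ℝ) * ((1 : ℝ) / 6) := by norm_num
  rw [e1, Real.rpow_natCast_mul hx]
  calc ((V : ℝ) ^ 5) ^ ((1 : ℝ) / 6) ≤ (((gainQ V : ℝ) / 1000000) ^ 6) ^ ((1 : ℝ) / 6) :=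
        Real.rpow_le_rpow (pow_nonneg hx 5) hle (by norm_num)
    _ = (gainQ V : ℝ) / 1000000 := by
        rw [show ((1 : ℝ) / 6) = ((6 : ℕ) : ℝ)⁻¹ by norm_num]
        exact Real.pow_rpow_inv_natCast (by positivity) (by norm_num)

variable {N : ℕ}

/-- a beating family of order `M ≤ 489` has integer gain above `10⁶·M` -/
theorem beats_gsumQ {M : ℕ} (a b c : Fin N → ℕ) (hS : SieveAdmissible M a b c) (hM : M ≤ 489)
    (hB : Beats (5 / 2) M a b c) : M * D < gsumQ (GM a b c) := by
  unfold Beats at hB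
  have hV : ∀ i, shapeVol a b c i ≤ 512 := fun i => by
    unfold SieveAdmissible at hS; dsimp only at hS; exact ((hS.1 i).2.2.2.trans hM).trans (by norm_num)
  have hsum : (M : ℝ) < ∑ i, ((gainQ (shapeVol a b c i) : ℝ) / 1000000) :=
    hB.trans_le (Finset.sum_le_sum fun i _ => rpow_le_gainQ _ (hV i))
  rw [← Finset.sum_div, lt_div_iff₀ (by norm_num)] at hsum
  have h2 : M * 1000000 < ∑ i, gainQ (shapeVol a b c i) := by exact_mod_cast hsum
  unfold gsumQ D; rw [sum_GM]; exact h2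

end gains

/-- **From the checker to the vQ shape exclusion at one order.**  If `checkQ M = true` (`M ≤ 489`), no shape list with at
least two members satisfying the vP sieve system and E3⁺ (`E3pAdm`) beats `5/2` at order `M`. -/
theorem shapeExclusionVQ_of_checkQ {M : ℕ} (hM : M ≤ 489) (hc : checkQ M = true) :
    ∀ (N : ℕ) (a b c : Fin N → ℕ), 2 ≤ N → SieveAdmissibleVP M a b c → E3pAdm M a b c → ¬ Beats (5 / 2) M a b c := by
  intro N a b c hN hVP hE hB
  obtain ⟨hS, hG, -⟩ := hVP
  exact checkQ_sound hc hM (GM a b c)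
    (fun x hx => by obtain ⟨i, rfl⟩ := (mem_GM a b c).mp hx; exact inUniv_shp a b c hN hS i)
    (admM_GM a b c hN hS) (admG_GM a b c hS hG) (admE_GM a b c hE) (beats_gsumQ a b c hS hM hB)

end Summit.MatrixMultiplication.MatrixMultiplication.Theorems.ShapeCertVQ
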